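import Literature.NumberTheory.Rogawski1990.BlockDetFrame
import Literature.NumberTheory.Rogawski1990.CartanInvariant
import Mathlib.Analysis.Matrix.PosDef
import HarnessLib

/-!
# At a DEFINITE place the block determinant of a Cartan class is a POSITIVE REAL
# (Rogawski 1990, §3.3 Prop. 3.3.1 — no archimedean obstruction at a definite place; §3.8 Prop. 3.8.1 (d))

Namespace `Literature.NumberTheory.Rogawski1990`; **THEOREMS ONLY** (no definition, no named fact, no instance, no notation, no `sorry`).
Cell `pub/hodgecm-mathlib`, ENGINE T1 (crux H413 = `stmt-HodgeConjecture-24833`), O7 «singular semisimple classes», piece **(h4)(i)-ℂ** of the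
`hreal` assembly for ★ `singularObs` (TRUNK WORDS #7 ∕ O7 OWNER WORD #12 (2)): the complex-linear-algebra core of «`adelicBlockDet` is a positive
real at every infinite place at which `H` is definite».

THE MATHEMATICS (over `ℂ`, any block sizes `N₁ + N₂`).  Let `H` be DEFINITE (`H.PosDef ∨ (−H).PosDef`), `Q` invertible with `Qᴴ H Q = H_a ⊕ᶠ H_b`
(a frame), `G` invertible and `X := H⁻¹ Gᴴ H G` (the Cartan class of `G`; `Gᴴ H G = twistGram conj H G`, ★ `CartanInvariant`) block-diagonal in
the frame, `X Q = Q (M_a ⊕ᶠ M_b)` (automatic for `X ∈ Z(γ)` in a frame of `γ`, ★ `exists_finSum_blockDet_lagrangeIdem_eq_det`).  Then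
`Qᴴ (H X) Q = (G Q)ᴴ H (G Q) = (H_a M_a) ⊕ᶠ (H_b M_b)` is definite of the sign of `H` (congruence), hence so are its blocks, and so are the blocks
`H_a`, `H_b` (principal submatrices); therefore **`det M_a = det (H_a M_a) ∕ det H_a` is a POSITIVE REAL** (§1–§2) and — reading the frame-free block
determinant of ★ `SingularObstruction` through ★ `blockDet_lagrangeIdem_eq_det` — **`blockDet (u • (γ − b•1)) X` is a positive real** for every `γ`
framed by `Q` (§3).  At an INDEFINITE place the sign of `det M_a` is `(−1)^{#neg(H_a M_a) − #neg(H_a)}`, NOT determined by `H` (TRUNK WORDS #8 (F2):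
the genuine archimedean obstruction) — nothing is claimed there.

HONEST LABEL: pure linear algebra over `ℂ`; the adelic reading at a complex place `w` (`π_∞`, ★ `snd_archProj_adeleConj`, `blockDet`∕`twistGram`
under ring maps) is the (h5) assembler's one-screen corollary; HC_CM is proved only modulo the printed citations until rung 0 closes.

## References
* [Rogawski1990] J. D. Rogawski, *Automorphic Representations of Unitary Groups in Three Variables*, Ann. of Math. Stud. 123 (1990), §3.3
  Prop. 3.3.1 p. 22; §3.8 Prop. 3.8.1 (d) p. 27.
* [HornJohnson2013] R. A. Horn, C. R. Johnson, *Matrix Analysis*, 2nd ed., Cambridge Univ. Press (2013), §7.1 Obs. 7.1.2 (principal submatrices),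
  Obs. 7.1.8 (congruence `Cᴴ A C`), §7.2 (determinant of a positive definite matrix is positive).
-/

set_option autoImplicit false

noncomputable section

open scoped Matrix MatrixGroups ComplexOrder

namespace Literature.NumberTheory.Rogawski1990

open Literature.NumberTheory.Automorphic.UnitaryGroup (finSum)

variable {N₁ N₂ : ℕ}

/-! ## §1 Definite complex matrices: determinants are non-zero reals of sign `(±1)^N`; blocks of a definite `A ⊕ᶠ B` are definite -/

/-- The determinant of a positive definite complex matrix is a POSITIVE REAL. [cite: HornJohnson2013, §7.2 p. 438; §7.1 Obs. 7.1.2 p. 430] -/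
theorem exists_det_eq_ofReal_pos_of_posDef {n : Type*} [Fintype n] [DecidableEq n] {A : Matrix n n ℂ} (hA : A.PosDef) :
    ∃ r : ℝ, 0 < r ∧ A.det = r := by
  obtain ⟨hre, him⟩ := Complex.lt_def.1 hA.det_pos
  simp only [Complex.zero_re, Complex.zero_im] at hre him
  exact ⟨A.det.re, hre, Complex.ext (by simp only [Complex.ofReal_re]) (by simp only [Complex.ofReal_im, ← him])⟩

/-- The determinant of a NEGATIVE definite complex matrix is `(−1)^{card n} · r` with `r > 0` real.
[cite: HornJohnson2013, §7.2 p. 438; §7.1 Obs. 7.1.2 p. 430] -/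
theorem exists_det_eq_neg_one_pow_mul_of_neg_posDef {n : Type*} [Fintype n] [DecidableEq n] {A : Matrix n n ℂ} (hA : (-A).PosDef) :
    ∃ r : ℝ, 0 < r ∧ A.det = (-1) ^ Fintype.card n * r := by
  obtain ⟨r, hr, hdet⟩ := exists_det_eq_ofReal_pos_of_posDef hA
  refine ⟨r, hr, ?_⟩
  rw [Matrix.det_neg] at hdet
  have h1 : ((-1 : ℂ) ^ Fintype.card n) * ((-1 : ℂ) ^ Fintype.card n) = 1 := by
    rw [← mul_pow, neg_mul_neg, one_mul, one_pow]
  calc A.det = ((-1 : ℂ) ^ Fintype.card n * (-1) ^ Fintype.card n) * A.det := by rw [h1, one_mul]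
    _ = (-1) ^ Fintype.card n * r := by rw [mul_assoc, hdet]

/-- Same-size matrices which are BOTH positive definite or BOTH negative definite have determinants of the SAME sign: `det B = det A · r`, `r > 0`,
`det A ≠ 0` (the `(±1)^n` cancel). [cite: HornJohnson2013, §7.2 p. 438; §7.1 Obs. 7.1.2 p. 430] -/
theorem exists_det_eq_det_mul_ofReal_pos_of_definite {n : Type*} [Fintype n] [DecidableEq n] {A B : Matrix n n ℂ}
    (h : (A.PosDef ∧ B.PosDef) ∨ ((-A).PosDef ∧ (-B).PosDef)) : ∃ r : ℝ, 0 < r ∧ A.det ≠ 0 ∧ B.det = A.det * r := by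
  rcases h with ⟨hA, hB⟩ | ⟨hA, hB⟩
  · obtain ⟨a, ha, hdA⟩ := exists_det_eq_ofReal_pos_of_posDef hA
    obtain ⟨b, hb, hdB⟩ := exists_det_eq_ofReal_pos_of_posDef hB
    have ha0 : (a : ℂ) ≠ 0 := by exact_mod_cast ha.ne'
    refine ⟨b / a, div_pos hb ha, by rw [hdA]; exact ha0, ?_⟩
    rw [hdA, hdB, Complex.ofReal_div, mul_div_cancel₀ _ ha0]
  · obtain ⟨a, ha, hdA⟩ := exists_det_eq_neg_one_pow_mul_of_neg_posDef hA
    obtain ⟨b, hb, hdB⟩ := exists_det_eq_neg_one_pow_mul_of_neg_posDef hB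
    have ha0 : (a : ℂ) ≠ 0 := by exact_mod_cast ha.ne'
    have hs : ((-1 : ℂ) ^ Fintype.card n) ≠ 0 := pow_ne_zero _ (neg_ne_zero.2 one_ne_zero)
    refine ⟨b / a, div_pos hb ha, by rw [hdA]; exact mul_ne_zero hs ha0, ?_⟩
    rw [hdA, hdB, Complex.ofReal_div, mul_assoc, mul_div_cancel₀ _ ha0]

/-- The first block of `A ⊕ᶠ B` is a principal submatrix: `(A ⊕ᶠ B).submatrix (Fin.castAdd N₂) (Fin.castAdd N₂) = A`. [folklore] -/
private theorem submatrix_finSum_castAdd {S : Type*} [CommRing S] (A : Matrix (Fin N₁) (Fin N₁) S) (B : Matrix (Fin N₂) (Fin N₂) S) :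
    (finSum N₁ N₂ A B).submatrix (Fin.castAdd N₂) (Fin.castAdd N₂) = A := by
  ext i j
  simp only [finSum, Matrix.reindex_apply, Matrix.submatrix_apply, finSumFinEquiv_symm_apply_castAdd, Matrix.fromBlocks_apply₁₁]

/-- The second block of `A ⊕ᶠ B` is a principal submatrix: `(A ⊕ᶠ B).submatrix (Fin.natAdd N₁) (Fin.natAdd N₁) = B`. [folklore] -/
private theorem submatrix_finSum_natAdd {S : Type*} [CommRing S] (A : Matrix (Fin N₁) (Fin N₁) S) (B : Matrix (Fin N₂) (Fin N₂) S) :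
    (finSum N₁ N₂ A B).submatrix (Fin.natAdd N₁) (Fin.natAdd N₁) = B := by
  ext i j
  simp only [finSum, Matrix.reindex_apply, Matrix.submatrix_apply, finSumFinEquiv_symm_apply_natAdd, Matrix.fromBlocks_apply₂₂]

/-- `−(A ⊕ᶠ B) = (−A) ⊕ᶠ (−B)`. [folklore] -/
private theorem neg_finSum {S : Type*} [CommRing S] (A : Matrix (Fin N₁) (Fin N₁) S) (B : Matrix (Fin N₂) (Fin N₂) S) :
    -finSum N₁ N₂ A B = finSum N₁ N₂ (-A) (-B) := by
  change (-Matrix.fromBlocks A 0 0 B).submatrix finSumFinEquiv.symm finSumFinEquiv.symm =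
    (Matrix.fromBlocks (-A) 0 0 (-B)).submatrix finSumFinEquiv.symm finSumFinEquiv.symm
  rw [Matrix.fromBlocks_neg]
  simp only [neg_zero]

/-- `(A ⊕ᶠ B)(C ⊕ᶠ D) = AC ⊕ᶠ BD`. [folklore] -/
private theorem finSum_mul_finSum {S : Type*} [CommRing S] (A C : Matrix (Fin N₁) (Fin N₁) S) (B D : Matrix (Fin N₂) (Fin N₂) S) :
    finSum N₁ N₂ A B * finSum N₁ N₂ C D = finSum N₁ N₂ (A * C) (B * D) := by
  simp only [finSum, Matrix.reindex_apply, Matrix.submatrix_mul_equiv, Matrix.fromBlocks_multiply, Matrix.mul_zero, Matrix.zero_mul,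
    add_zero, zero_add]

/-- **The blocks of a positive definite `A ⊕ᶠ B` are positive definite** (principal submatrices). [cite: HornJohnson2013, §7.1 Obs. 7.1.2 p. 430] -/
theorem posDef_blocks_of_posDef_finSum {A : Matrix (Fin N₁) (Fin N₁) ℂ} {B : Matrix (Fin N₂) (Fin N₂) ℂ} (h : (finSum N₁ N₂ A B).PosDef) :
    A.PosDef ∧ B.PosDef := by
  constructor
  · have h1 := h.submatrix (Fin.castAdd_injective N₁ N₂)
    rwa [submatrix_finSum_castAdd] at h1
  · have h2 := h.submatrix (Fin.natAdd_injective N₂ N₁)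
    rwa [submatrix_finSum_natAdd] at h2

/-- **The blocks of a DEFINITE `A ⊕ᶠ B` are definite OF THE SAME SIGN.** [cite: HornJohnson2013, §7.1 Obs. 7.1.2 p. 430] -/
theorem definite_blocks_of_definite_finSum {A : Matrix (Fin N₁) (Fin N₁) ℂ} {B : Matrix (Fin N₂) (Fin N₂) ℂ}
    (h : (finSum N₁ N₂ A B).PosDef ∨ (-finSum N₁ N₂ A B).PosDef) :
    (A.PosDef ∧ B.PosDef) ∨ ((-A).PosDef ∧ (-B).PosDef) := by
  rcases h with h | h
  · exact Or.inl (posDef_blocks_of_posDef_finSum h)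
  · rw [neg_finSum] at h
    exact Or.inr (posDef_blocks_of_posDef_finSum h)

/-- **Congruence preserves definiteness (with its sign)**: `Bᴴ A B` is definite of the sign of `A` for `B` with injective `mulVec`.
[cite: HornJohnson2013, §7.1 Obs. 7.1.8 p. 431] -/
theorem definite_conjTranspose_mul_mul_same {n m : Type*} [Fintype n] [Fintype m] {A : Matrix n n ℂ} {B : Matrix n m ℂ}
    (h : A.PosDef ∨ (-A).PosDef) (hB : Function.Injective B.mulVec) : (Bᴴ * A * B).PosDef ∨ (-(Bᴴ * A * B)).PosDef := by
  rcases h with h | h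
  · exact Or.inl (h.conjTranspose_mul_mul_same hB)
  · refine Or.inr ?_
    rw [← Matrix.neg_mul, ← Matrix.mul_neg]
    exact h.conjTranspose_mul_mul_same hB

/-! ## §2 The first block of a Cartan class in a frame has POSITIVE REAL determinant at a definite place -/

/-- The framed congruent of `H X`, `X = H⁻¹ Gᴴ H G`: **`(G Q)ᴴ H (G Q) = (H_a M_a) ⊕ᶠ (H_b M_b)`** when `Qᴴ H Q = H_a ⊕ᶠ H_b` and `X Q = Q (M_a ⊕ᶠ M_b)`.
[cite: Rogawski1990, §3.8 Prop. 3.8.1 (d) p. 27] -/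
theorem conjTranspose_mul_mul_eq_finSum_of_frame {H Q G : Matrix (Fin (N₁ + N₂)) (Fin (N₁ + N₂)) ℂ} (hH : IsUnit H)
    {Ha Ma : Matrix (Fin N₁) (Fin N₁) ℂ} {Hb Mb : Matrix (Fin N₂) (Fin N₂) ℂ} (hP : Qᴴ * H * Q = finSum N₁ N₂ Ha Hb)
    (hXP : H⁻¹ * Gᴴ * H * G * Q = Q * finSum N₁ N₂ Ma Mb) : (G * Q)ᴴ * H * (G * Q) = finSum N₁ N₂ (Ha * Ma) (Hb * Mb) := by
  have hHi : H * H⁻¹ = 1 := Matrix.mul_nonsing_inv H ((Matrix.isUnit_iff_isUnit_det H).1 hH)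
  calc (G * Q)ᴴ * H * (G * Q) = Qᴴ * (H * H⁻¹) * (Gᴴ * H * G * Q) := by
          rw [hHi, Matrix.mul_one, Matrix.conjTranspose_mul]; simp only [Matrix.mul_assoc]
    _ = Qᴴ * H * (H⁻¹ * Gᴴ * H * G * Q) := by simp only [Matrix.mul_assoc]
    _ = finSum N₁ N₂ (Ha * Ma) (Hb * Mb) := by rw [hXP, ← Matrix.mul_assoc, hP, finSum_mul_finSum]

/-- **`det M_a > 0` AT A POSITIVE DEFINITE PLACE.**  `H` positive definite, `Q` invertible with `Qᴴ H Q = H_a ⊕ᶠ H_b`, `G` invertible, `X := H⁻¹ Gᴴ H G`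
with `X Q = Q (M_a ⊕ᶠ M_b)`: then `det M_a = r ∈ ℝ_{>0}` (`H_a M_a` and `H_a` are positive definite and `det M_a = det (H_a M_a) ∕ det H_a`).
[cite: Rogawski1990, §3.3 Prop. 3.3.1 p. 22; §3.8 Prop. 3.8.1 (d) p. 27] [cite: HornJohnson2013, §7.1 Obs. 7.1.2, Obs. 7.1.8 pp. 430–431] -/
theorem exists_det_block_eq_ofReal_pos_of_posDef_frame {H Q G : Matrix (Fin (N₁ + N₂)) (Fin (N₁ + N₂)) ℂ} (hH : H.PosDef)
    (hQ : IsUnit Q) (hG : IsUnit G) {Ha Ma : Matrix (Fin N₁) (Fin N₁) ℂ} {Hb Mb : Matrix (Fin N₂) (Fin N₂) ℂ}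
    (hP : Qᴴ * H * Q = finSum N₁ N₂ Ha Hb) (hXP : H⁻¹ * Gᴴ * H * G * Q = Q * finSum N₁ N₂ Ma Mb) :
    ∃ r : ℝ, 0 < r ∧ Ma.det = r := by
  have h1 := hH.conjTranspose_mul_mul_same (Matrix.mulVec_injective_iff_isUnit.2 hQ)
  have h2 := hH.conjTranspose_mul_mul_same (Matrix.mulVec_injective_iff_isUnit.2 (hG.mul hQ))
  rw [hP] at h1
  rw [conjTranspose_mul_mul_eq_finSum_of_frame hH.isUnit hP hXP] at h2
  obtain ⟨r, hr, hda, hdet⟩ := exists_det_eq_det_mul_ofReal_pos_of_definite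
    (Or.inl ⟨(posDef_blocks_of_posDef_finSum h1).1, (posDef_blocks_of_posDef_finSum h2).1⟩)
  refine ⟨r, hr, mul_left_cancel₀ hda ?_⟩
  rw [← Matrix.det_mul, hdet]

/-- **`det M_a > 0` AT A DEFINITE PLACE (either sign).**  `H` definite (`H.PosDef ∨ (−H).PosDef`), `Q` invertible with `Qᴴ H Q = H_a ⊕ᶠ H_b`, `G`
invertible, `X := H⁻¹ Gᴴ H G` with `X Q = Q (M_a ⊕ᶠ M_b)`: then `det M_a = r ∈ ℝ_{>0}` (the negative definite case is the positive one for `−H`, which has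
the same `X`).  No archimedean obstruction at a definite place. [cite: Rogawski1990, §3.3 Prop. 3.3.1 p. 22; §3.8 Prop. 3.8.1 (d) p. 27] -/
theorem exists_det_block_eq_ofReal_pos_of_definite_frame {H Q G : Matrix (Fin (N₁ + N₂)) (Fin (N₁ + N₂)) ℂ} (hdef : H.PosDef ∨ (-H).PosDef)
    (hQ : IsUnit Q) (hG : IsUnit G) {Ha Ma : Matrix (Fin N₁) (Fin N₁) ℂ} {Hb Mb : Matrix (Fin N₂) (Fin N₂) ℂ}
    (hP : Qᴴ * H * Q = finSum N₁ N₂ Ha Hb) (hXP : H⁻¹ * Gᴴ * H * G * Q = Q * finSum N₁ N₂ Ma Mb) :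
    ∃ r : ℝ, 0 < r ∧ Ma.det = r := by
  rcases hdef with h | h
  · exact exists_det_block_eq_ofReal_pos_of_posDef_frame h hQ hG hP hXP
  · have hHu : IsUnit H := by simpa only [neg_neg] using h.isUnit.neg
    have hneg : (-H)⁻¹ = -H⁻¹ :=
      Matrix.inv_eq_right_inv (by rw [neg_mul_neg, Matrix.mul_nonsing_inv H ((Matrix.isUnit_iff_isUnit_det H).1 hHu)])
    refine exists_det_block_eq_ofReal_pos_of_posDef_frame h hQ hG (Ha := -Ha) (Hb := -Hb) (Mb := Mb) ?_ ?_
    · rw [Matrix.mul_neg, Matrix.neg_mul, hP, neg_finSum]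
    · rw [hneg, Matrix.neg_mul, neg_mul_neg]
      exact hXP

/-! ## §3 Frame-free readings: `blockDet (u • (γ − b•1)) X` is a positive real at a definite place (`Gᴴ H G` and `twistGram conj H G` letters) -/

/-- **NO ARCHIMEDEAN OBSTRUCTION AT A DEFINITE PLACE: `blockDet e X ∈ ℝ_{>0}`.**  With `γ` framed by `P` (`γ P = P (a·1 ⊕ᶠ b·1)`, `u (a − b) = 1`,
`Pᴴ H P = H_a ⊕ᶠ H_b`), `G` invertible and `X = H⁻¹ Gᴴ H G` block-diagonal in that frame, the frame-free block determinant `blockDet (u • (γ − b•1)) X`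
(`= det M_a`, ★ `blockDet_lagrangeIdem_eq_det`) is a POSITIVE REAL whenever `H` is definite. [cite: Rogawski1990, §3.3 Prop. 3.3.1 p. 22; §3.8 Prop. 3.8.1 (d) p. 27] -/
theorem exists_blockDet_eq_ofReal_pos_of_definite_frame {H γ G : Matrix (Fin (N₁ + N₂)) (Fin (N₁ + N₂)) ℂ} (hdef : H.PosDef ∨ (-H).PosDef)
    (P : GL (Fin (N₁ + N₂)) ℂ) (hG : IsUnit G) {a b u : ℂ} {Ha Ma : Matrix (Fin N₁) (Fin N₁) ℂ} {Hb Mb : Matrix (Fin N₂) (Fin N₂) ℂ}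
    (hP : (P : Matrix (Fin (N₁ + N₂)) (Fin (N₁ + N₂)) ℂ)ᴴ * H * (P : Matrix (Fin (N₁ + N₂)) (Fin (N₁ + N₂)) ℂ) = finSum N₁ N₂ Ha Hb)
    (hγP : γ * (P : Matrix (Fin (N₁ + N₂)) (Fin (N₁ + N₂)) ℂ) =
      (P : Matrix (Fin (N₁ + N₂)) (Fin (N₁ + N₂)) ℂ) * finSum N₁ N₂ (a • (1 : Matrix (Fin N₁) (Fin N₁) ℂ)) (b • (1 : Matrix (Fin N₂) (Fin N₂) ℂ)))
    (hu : u * (a - b) = 1)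
    (hXP : H⁻¹ * Gᴴ * H * G * (P : Matrix (Fin (N₁ + N₂)) (Fin (N₁ + N₂)) ℂ) = (P : Matrix (Fin (N₁ + N₂)) (Fin (N₁ + N₂)) ℂ) * finSum N₁ N₂ Ma Mb) :
    ∃ r : ℝ, 0 < r ∧ blockDet (u • (γ - b • (1 : Matrix (Fin (N₁ + N₂)) (Fin (N₁ + N₂)) ℂ))) (H⁻¹ * Gᴴ * H * G) = r := by
  obtain ⟨r, hr, hdet⟩ := exists_det_block_eq_ofReal_pos_of_definite_frame hdef (Units.isUnit P) hG hP hXP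
  exact ⟨r, hr, by rw [blockDet_lagrangeIdem_eq_det hγP hu hXP, hdet]⟩

/-- The same in `re`∕`im` letters (the (h4)(i) socket shape «`0 < (…).re`»). [cite: Rogawski1990, §3.3 Prop. 3.3.1 p. 22; §3.8 Prop. 3.8.1 (d) p. 27] -/
theorem blockDet_re_pos_of_definite_frame {H γ G : Matrix (Fin (N₁ + N₂)) (Fin (N₁ + N₂)) ℂ} (hdef : H.PosDef ∨ (-H).PosDef)
    (P : GL (Fin (N₁ + N₂)) ℂ) (hG : IsUnit G) {a b u : ℂ} {Ha Ma : Matrix (Fin N₁) (Fin N₁) ℂ} {Hb Mb : Matrix (Fin N₂) (Fin N₂) ℂ}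
    (hP : (P : Matrix (Fin (N₁ + N₂)) (Fin (N₁ + N₂)) ℂ)ᴴ * H * (P : Matrix (Fin (N₁ + N₂)) (Fin (N₁ + N₂)) ℂ) = finSum N₁ N₂ Ha Hb)
    (hγP : γ * (P : Matrix (Fin (N₁ + N₂)) (Fin (N₁ + N₂)) ℂ) =
      (P : Matrix (Fin (N₁ + N₂)) (Fin (N₁ + N₂)) ℂ) * finSum N₁ N₂ (a • (1 : Matrix (Fin N₁) (Fin N₁) ℂ)) (b • (1 : Matrix (Fin N₂) (Fin N₂) ℂ)))
    (hu : u * (a - b) = 1)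
    (hXP : H⁻¹ * Gᴴ * H * G * (P : Matrix (Fin (N₁ + N₂)) (Fin (N₁ + N₂)) ℂ) = (P : Matrix (Fin (N₁ + N₂)) (Fin (N₁ + N₂)) ℂ) * finSum N₁ N₂ Ma Mb) :
    0 < (blockDet (u • (γ - b • (1 : Matrix (Fin (N₁ + N₂)) (Fin (N₁ + N₂)) ℂ))) (H⁻¹ * Gᴴ * H * G)).re ∧
      (blockDet (u • (γ - b • (1 : Matrix (Fin (N₁ + N₂)) (Fin (N₁ + N₂)) ℂ))) (H⁻¹ * Gᴴ * H * G)).im = 0 := by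
  obtain ⟨r, hr, h⟩ := exists_blockDet_eq_ofReal_pos_of_definite_frame hdef P hG hP hγP hu hXP
  rw [h, Complex.ofReal_re, Complex.ofReal_im]
  exact ⟨hr, rfl⟩

/-- Over `ℂ` with `σ = conj`, the transported Gram matrix of ★ `CartanInvariant` is `twistGram conj H G = Gᴴ H G`. [cite: Rogawski1990, §3.1 p. 19] -/
theorem twistGram_starRingEnd_eq {n : Type*} [Fintype n] (H G : Matrix n n ℂ) : twistGram (starRingEnd ℂ) H G = Gᴴ * H * G := by
  rw [twistGram_def]
  congr 2

/-- **(h4)(i)-ℂ in `twistGram` letters** (the spelling of ★ `adelicBlockDet` read at a complex place): for `H` definite, `P` a frame of `γ` with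
`ᵗP̄ H P = H_a ⊕ᶠ H_b`, `G` invertible and `H⁻¹ · twistGram conj H G` block-diagonal in the frame, `blockDet (u • (γ − b•1)) (H⁻¹ · twistGram conj H G)`
has POSITIVE real part and ZERO imaginary part. [cite: Rogawski1990, §3.3 Prop. 3.3.1 p. 22; §3.8 Prop. 3.8.1 (d) p. 27] -/
theorem blockDet_twistGram_re_pos_of_definite_frame {H γ G : Matrix (Fin (N₁ + N₂)) (Fin (N₁ + N₂)) ℂ} (hdef : H.PosDef ∨ (-H).PosDef)
    (P : GL (Fin (N₁ + N₂)) ℂ) (hG : IsUnit G) {a b u : ℂ} {Ha Ma : Matrix (Fin N₁) (Fin N₁) ℂ} {Hb Mb : Matrix (Fin N₂) (Fin N₂) ℂ}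
    (hP : twistGram (starRingEnd ℂ) H (P : Matrix (Fin (N₁ + N₂)) (Fin (N₁ + N₂)) ℂ) = finSum N₁ N₂ Ha Hb)
    (hγP : γ * (P : Matrix (Fin (N₁ + N₂)) (Fin (N₁ + N₂)) ℂ) =
      (P : Matrix (Fin (N₁ + N₂)) (Fin (N₁ + N₂)) ℂ) * finSum N₁ N₂ (a • (1 : Matrix (Fin N₁) (Fin N₁) ℂ)) (b • (1 : Matrix (Fin N₂) (Fin N₂) ℂ)))
    (hu : u * (a - b) = 1)
    (hXP : H⁻¹ * twistGram (starRingEnd ℂ) H G * (P : Matrix (Fin (N₁ + N₂)) (Fin (N₁ + N₂)) ℂ) =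
      (P : Matrix (Fin (N₁ + N₂)) (Fin (N₁ + N₂)) ℂ) * finSum N₁ N₂ Ma Mb) :
    0 < (blockDet (u • (γ - b • (1 : Matrix (Fin (N₁ + N₂)) (Fin (N₁ + N₂)) ℂ))) (H⁻¹ * twistGram (starRingEnd ℂ) H G)).re ∧
      (blockDet (u • (γ - b • (1 : Matrix (Fin (N₁ + N₂)) (Fin (N₁ + N₂)) ℂ))) (H⁻¹ * twistGram (starRingEnd ℂ) H G)).im = 0 := by
  rw [twistGram_starRingEnd_eq] at hP hXP ⊢
  rw [← Matrix.mul_assoc, ← Matrix.mul_assoc] at hXP ⊢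
  exact blockDet_re_pos_of_definite_frame hdef P hG hP hγP hu hXP

end Literature.NumberTheory.Rogawski1990

end
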